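import Summits.Ventures.Crystal3D.Theorems.StickyWulffConstantTextureLiminfTexShadowLevelReachBornRootFree
import Summits.Ventures.Crystal3D.Theorems.StickyWulffConstantTextureLiminfTexShadowLevelReachHexagonBarlowShape
import HarnessLib

/-!
# The BORN census of a lamella family in the clamped two-plate cell (discharges verbatim from lane F; no core-rigidity hypothesis)
# (lane T, crux `TextureLiminfV5`, stmt-Ventures-23912, registered stub `stub_terraceCensus`; (β) assembly RESUME (d) — cf-p1 (cccxii) GO)

HONEST FRAMING. Venture `Summits/Ventures/Crystal3D` (cell `crystal3d-full`), route `route-Ventures-StickyWulffConstant`, helper `--supports` the law-v5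
crux `TextureLiminfV5` (stmt-Ventures-23912), lane T, mechanism (β).  Census-free, certificate-free; `KissingGap δ`, `KissingClassification δ` BY NAME;
nothing about energies; F-C1 not moved.

THE POINT.  `born_endPairs_launch_root_free` (…LevelReachBornRootFree: the born census with the bottom core-rigidity hypothesis removed) INSTANTIATED in the
clamped two-plate cell of the (β) plates side (…LevelReachHexagonBarlowShape, same cell hypotheses `hP₁`, `hP₂`, `hX`, `R₀ ≥ 5`, `ρ ≥ R₀ + 2`) for an
ARBITRARY launch frame `A` (a lamella frame of the filling) and root slot `w` with `A w` RISING, the launch dozen being neither of the top plate's two dozens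
(`hneA₁`, `hneA₂`): every remaining hypothesis of the abstract born census is discharged exactly as for the plate censuses — the word data over the base
frame `A` (`Fw`, `uw`, `WFw`, `nextw`), the canonical all-cut predicate `C μ :↔ ⟪w, μ⟫ = √(2/3)`, the bottom seal set = the bottom plate's core band
(`sealing_below_barlow`; its core rigidity is no longer asked), the top seal set = the top plate's band (`sealing_above_barlow`, `topBand₂_deep`) with the
ROOT-frame top exclusion by 19481-p2's `frame_of_face_receivingPlateBall`.  Output **`born_barlow_endPairs`**:
`#{born launches stepping into the window} ≤ #T + #CUT + 220·(#rim_top + #rim_bot)` with lane F's pair / two-payer clauses and the ROOT-CLASS END MOVE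
in the launch frame, `bq.1 − A w ∈ X ∧ bq.2 = bq.1 − A w ∧ ¬ IsMoving X ver A (A w) bq.1 ∧ bq.2 − A w ∈ X ∧ IsEndMove X ver A (A w) bq.2 bq.1` — the shape
`isEndPairA_of_rootMove` (p749779) pools under the bi-frame row once `(basalSystem Fr).Adm A (A w)` is presented (`PlateSystem.adm_fw_singleton_of_crossed`,
p750661, for the plate-adjacent lamella `A = (basalSystem Fr).Fw [μ₁]`, `w = −r`).
WHAT THIS IS NOT: any lower bound on the number of born launches (born SUPPLY), the pooling, the falling (top-plate) twin of this census, any certificate;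
F-C1 not moved.
-/

noncomputable section

namespace Summit.Ventures.Crystal3D.Theorems

open Summit.Ventures.Crystal3D Finset
open Literature.MathematicalPhysics.StatisticalMechanics (barlowPos barlowStacking IsHaggSeq barlowPos_mem basalMirror)
open Summit.Ventures.Crystal3D.Cruxes.TextureLiminf.TexShadow (E3 stacking)
open scoped InnerProductSpace

set_option maxHeartbeats 400000 in
open scoped Classical in
/-- **The born census of a lamella family in the clamped two-plate cell.**  Cell data as in `hexagon_barlow_endPairs_cuts_shape`; launch frame `A` with
`A`-dozen neither the top plate's dozen nor its basal twin's (`hneA₁`, `hneA₂`); root slot `w`, `A w` rising; BORN launch set `B`: balls of `X` FULL in the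
frame `A` with predecessor `p − A w ∈ X` which is NOT a trackable straight mover with its own predecessor (`hborn`).  Conclusion: the born launches whose first
step lands in the window `(−(R₀+1)−1, h+(R₀+1)+1)` number at most `#T + #CUT + 220·(#rim_top + #rim_bot)`, `CUT` = located root-class readings of the cut
planes (`⟪w, μ⟫ = √(2/3)`) reached by a root line, `T` with the pair / two-payer clauses and the root-class end move in the frame `A`. -/
theorem born_barlow_endPairs (ver : WordVersion) {δ : ℝ} (hg : KissingGap δ) (hc : KissingClassification δ)
    {σ₁ σ₂ : ℤ → ℤ} (hσ₂ : IsHaggSeq σ₂) (L₁ L₂ : E3 ≃ₗᵢ[ℝ] E3) (s₁ s₂ : E3)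
    (A : E3 ≃ₗᵢ[ℝ] E3)
    (hneA₁ : (A : E3 → E3) '' ↑fccSlots ≠ (L₂ : E3 → E3) '' ↑fccSlots)
    (hneA₂ : (A : E3 → E3) '' ↑fccSlots ≠ ((basalMirror.trans L₂ : E3 ≃ₗᵢ[ℝ] E3) : E3 → E3) '' ↑fccSlots)
    {w : E3} (hw : w ∈ fccSlots) (hup : 0 < (A w) 2)
    (X P₁ P₂ : Finset E3) (R₀ h ρ : ℝ) (hR₀ : 5 ≤ R₀) (hρ : R₀ + 2 ≤ ρ)
    (hX : ∀ p ∈ X, ∀ q ∈ X, p ≠ q → 1 ≤ dist p q) (hP₁X : P₁ ⊆ X) (hP₂X : P₂ ⊆ X)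
    (hP₁ : ∀ p, p ∈ P₁ ↔ (p ∈ stacking L₁ s₁ σ₁ ∧ -(2 * R₀) ≤ p 2 ∧ p 2 ≤ -R₀ ∧ p 0 ^ 2 + p 1 ^ 2 ≤ ρ ^ 2))
    (hP₂ : ∀ p, p ∈ P₂ ↔ (p ∈ stacking L₂ s₂ σ₂ ∧ h + R₀ ≤ p 2 ∧ p 2 ≤ h + 2 * R₀ ∧ p 0 ^ 2 + p 1 ^ 2 ≤ ρ ^ 2))
    (B : Finset E3)
    (hborn : ∀ p ∈ B, p ∈ X ∧ IsFull X A p ∧ p - A w ∈ X ∧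
      ¬ (p - A w - A w ∈ X ∧
        (IsFull X A (p - A w) ∨ (∃ m, IsTwinReading X A m (p - A w) ∧ ⟪A w, m⟫_ℝ = 0) ∨
          (ver = WordVersion.v2 ∧ IsNarrow X A (A w) (p - A w))))) :
    ∃ T : Finset (E3 × E3),
      (B.filter fun p => -(R₀ + 1) - 1 < (p + A w) 2 ∧ (p + A w) 2 < h + (R₀ + 1) + 1).card ≤
        T.card +
        (X.filter fun b => -(R₀ + 1) - 1 ≤ b 2 ∧ b 2 < h + (R₀ + 1) + 1 ∧
            (∃ μ, ⟪w, μ⟫_ℝ = Real.sqrt (2 / 3) ∧ IsTwinReading X A (A μ) b) ∧ b - A w ∈ X).card +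
        220 * (X.filter fun s => h + (R₀ + 1) + 1 ≤ s 2 ∧ s 2 ≤ h + (R₀ + 1) + 1 + 1 ∧
            (ρ - 1 - 2) ^ 2 < s 0 ^ 2 + s 1 ^ 2).card +
        220 * (X.filter fun s => -(R₀ + 1) - 1 - 1 ≤ s 2 ∧ s 2 < -(R₀ + 1) - 1 ∧
            (ρ - 1 - 1) ^ 2 < s 0 ^ 2 + s 1 ^ 2).card ∧
      (∀ bq ∈ T, bq.1 ∈ X ∧ bq.2 ∈ X ∧ dist bq.1 bq.2 = 1 ∧ -(R₀ + 1) - 1 ≤ bq.1 2 ∧ bq.1 2 < h + (R₀ + 1) + 1) ∧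
      (∀ bq ∈ T, (X.filter fun q => dist bq.1 q = 1).card ≤ 11 ∨
        ∃ z₁ ∈ X, ∃ z₂ ∈ X, z₁ ≠ z₂ ∧ dist bq.1 z₁ = 1 ∧ dist bq.1 z₂ = 1 ∧
          (X.filter fun q => dist z₁ q = 1).card ≤ 11 ∧ (X.filter fun q => dist z₂ q = 1).card ≤ 11) ∧
      (∀ bq ∈ T, bq.1 - A w ∈ X ∧ bq.2 = bq.1 - A w ∧ ¬ IsMoving X ver A (A w) bq.1 ∧
        bq.2 - A w ∈ X ∧ IsEndMove X ver A (A w) bq.2 bq.1) := by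
  -- the word data over the base frame `A`, root `w`
  set Fw : List E3 → (E3 ≃ₗᵢ[ℝ] E3) := fun κ => κ.foldr (fun μ G => ((ℝ ∙ μ)ᗮ.reflection).trans G) A with hFw
  set uw : List E3 → E3 := fun κ => κ.foldr (fun _ v => -v) w with huw
  set WFw : List E3 → Prop := fun κ =>
    List.rec (motive := fun _ => Prop) True (fun μ κ' ih => ih ∧ ‖μ‖ = 1 ∧
      (∀ w' ∈ fccSlots, ⟪w', μ⟫_ℝ = 0 ∨ ⟪w', μ⟫_ℝ = Real.sqrt (2 / 3) ∨ ⟪w', μ⟫_ℝ = -Real.sqrt (2 / 3)) ∧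
      ⟪uw κ', μ⟫_ℝ = Real.sqrt (2 / 3) ∧ ∀ μ' κ'', κ' = μ' :: κ'' → μ' ≠ -μ) κ with hWFw
  set nextw : List E3 → E3 → List E3 :=
    fun κ m => @ite _ (∃ μ κ', κ = μ :: κ' ∧ (Fw κ).symm m = -μ) (Classical.propDecidable _) κ.tail
      ((Fw κ).symm m :: κ) with hnextw
  have hF0 : Fw [] = A := rfl
  have hFc : ∀ μ κ, Fw (μ :: κ) = ((ℝ ∙ μ)ᗮ.reflection).trans (Fw κ) := fun _ _ => rfl
  have hu0 : uw [] = w := rfl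
  have huc : ∀ μ κ, uw (μ :: κ) = -uw κ := fun _ _ => rfl
  have hWF0 : WFw [] := trivial
  have hWFc : ∀ μ κ, WFw (μ :: κ) ↔ (WFw κ ∧ ‖μ‖ = 1 ∧
      (∀ w' ∈ fccSlots, ⟪w', μ⟫_ℝ = 0 ∨ ⟪w', μ⟫_ℝ = Real.sqrt (2 / 3) ∨ ⟪w', μ⟫_ℝ = -Real.sqrt (2 / 3)) ∧
      ⟪uw κ, μ⟫_ℝ = Real.sqrt (2 / 3) ∧ ∀ μ' κ', κ = μ' :: κ' → μ' ≠ -μ) := fun _ _ => Iff.rfl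
  have hnext_pop : ∀ μ κ' (m : E3), (Fw (μ :: κ')).symm m = -μ → nextw (μ :: κ') m = κ' := by
    intro μ κ' m hν
    simp only [hnextw]
    rw [if_pos ⟨μ, κ', rfl, hν⟩, List.tail_cons]
  have hnext_push : ∀ κ (m : E3), (∀ μ κ', κ = μ :: κ' → (Fw κ).symm m ≠ -μ) → nextw κ m = (Fw κ).symm m :: κ := by
    intro κ m hnp
    simp only [hnextw]
    rw [if_neg]
    rintro ⟨μ, κ', h', hν⟩
    exact hnp μ κ' h' hν
  clear_value nextw WFw uw Fw
  have hu : ∀ κ, uw κ ∈ fccSlots := word_u_mem hw hu0 huc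
  -- the cell: top clamp, core band, top band
  set W₂ : Set E3 := {x : E3 | h + R₀ ≤ x 2 ∧ x 2 ≤ h + 2 * R₀ ∧ x 0 ^ 2 + x 1 ^ 2 ≤ ρ ^ 2} with hW₂
  have hplate₂ : ∀ p ∈ stacking L₂ s₂ σ₂, p ∈ W₂ → p ∈ X := plate_mem_of_clamp₂ L₂ s₂ hP₂X hP₂
  set CORE := P₁.filter (fun p => -(R₀ + 1) - 1 - 1 ≤ p 2 ∧ p 2 ≤ -(R₀ + 1) - 1 ∧
    p 0 ^ 2 + p 1 ^ 2 ≤ (ρ - 1 - 1) ^ 2) with hCORE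
  set TOP := P₂.filter (fun p => h + (R₀ + 1) + 1 ≤ p 2 ∧ p 2 ≤ h + (R₀ + 1) + 1 + 1 ∧
    p 0 ^ 2 + p 1 ^ 2 ≤ (ρ - 1 - 2) ^ 2) with hTOP
  have htop : ∀ p ∈ TOP, ∃ k i j : ℤ, p = L₂ (barlowPos 1 (Real.sqrt (2 / 3)) σ₂ k i j) + s₂ ∧
      ∀ x, dist p x ≤ 2 → x ∈ W₂ := topBand₂_deep L₂ s₂ hP₂ hR₀ (by linarith)
  -- (1) the canonical all-cut predicate
  set C : E3 → Prop := fun μ => ⟪w, μ⟫_ℝ = Real.sqrt (2 / 3) with hCdef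
  have hC : ∀ μ, C μ → ⟪uw [], μ⟫_ℝ = Real.sqrt (2 / 3) := fun μ hμ => by rw [hu0]; exact hμ
  have hCall : ∀ m, IsMenuNormal (Fw []) m → ⟪Fw [] (uw []), m⟫_ℝ = Real.sqrt (2 / 3) → C ((Fw []).symm m) := by
    intro m _ hdm
    show ⟪w, (Fw []).symm m⟫_ℝ = Real.sqrt (2 / 3)
    rw [← LinearIsometryEquiv.inner_map_map (Fw []), LinearIsometryEquiv.apply_symm_apply, ← hu0]; exact hdm
  -- (2) ROOT-frame top exclusion at the clamped receiving plate (the launch dozen is neither top dozen)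
  have hPexcl0root : ∀ b : E3, b ∈ TOP →
      (∃ a ∈ fccSlots, ∃ a' ∈ fccSlots, ∃ a'' ∈ fccSlots,
        ⟪a, a'⟫_ℝ = 1 / 2 ∧ ⟪a, a''⟫_ℝ = 1 / 2 ∧ ⟪a', a''⟫_ℝ = 1 / 2 ∧
        b + Fw [] a ∈ X ∧ b + Fw [] a' ∈ X ∧ b + Fw [] a'' ∈ X) → False := by
    intro b hb htri
    obtain ⟨k, i, j, rfl, hW⟩ := htop b hb
    obtain ⟨a, ha, a', ha', a'', ha'', i1, i2, i3, h1, h2, h3⟩ := htri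
    rcases frame_of_face_receivingPlateBall hσ₂ L₂ s₂ hX hplate₂ k i j hW (Fw []) ha ha' ha'' i1 i2 i3 h1 h2 h3 with h' | h'
    · rw [hF0] at h'; exact hneA₁ h'
    · rw [hF0] at h'; exact hneA₂ h'
  -- (3) sealing (lane F): the bottom core band needs NO rigidity any more
  have hsealB := sealing_below_barlow L₁ s₁ hX hP₁X hP₁ (R₀ := R₀) (ρ := ρ) (by linarith) (by linarith)
  have hP₂seal := sealing_above_barlow L₂ s₂ hX hP₂X hP₂ (R₀ := R₀) (h := h) (ρ := ρ) (by linarith) (by linarith)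
  have hP'top : ∀ p ∈ CORE, p 2 ≤ -(R₀ + 1) - 1 := fun p hp => (mem_filter.1 hp).2.2.1
  -- (4) the born launch set in word-data form
  have hup' : 0 < (Fw [] (uw [])) 2 := by rw [hF0, hu0]; exact hup
  have hborn' : ∀ p ∈ B, p ∈ X ∧ IsFull X (Fw []) p ∧ p - Fw [] (uw []) ∈ X ∧
      ¬ (p - Fw [] (uw []) - Fw [] (uw []) ∈ X ∧
        (IsFull X (Fw []) (p - Fw [] (uw [])) ∨
          (∃ m, IsTwinReading X (Fw []) m (p - Fw [] (uw [])) ∧ ⟪Fw [] (uw []), m⟫_ℝ = 0) ∨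
          (ver = WordVersion.v2 ∧ IsNarrow X (Fw []) (Fw [] (uw [])) (p - Fw [] (uw []))))) := by
    intro p hp; rw [hF0, hu0]; exact hborn p hp
  -- (5) the abstract born census, no core rigidity
  obtain ⟨T, hkey, hTpair, hTpay, hTmove⟩ := born_endPairs_launch_root_free ver (F := Fw) (u := uw) (WF := WFw) (next := nextw)
    (P' := CORE) (P₂ := TOP) (R₀ := R₀ + 1) (h := h) (ρ := ρ - 1) hg hc hX hFc hu huc hWF0 hWFc hnext_pop hnext_push C hC hCall
    hPexcl0root hup' (by linarith : (3 : ℝ) ≤ R₀ + 1) (by linarith : R₀ + 1 ≤ ρ - 1) B hborn'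
    (fun p hp => by have := hP'top p hp; linarith) hsealB hP₂seal
  rw [hF0, hu0] at hkey hTmove
  simp only [hCdef] at hkey
  exact ⟨T, hkey, hTpair, hTpay, hTmove⟩

end Summit.Ventures.Crystal3D.Theorems

end
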